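import Literature.MathematicalPhysics.KineticTheory.InfiniteChainDynamics
import Literature.MathematicalPhysics.KineticTheory.InfiniteChainAbelWitness
import Literature.MathematicalPhysics.KineticTheory.InfiniteChainGibbsInvariance
import Literature.MathematicalPhysics.KineticTheory.InfiniteChainGibbsExistence
import Literature.Barriers.CriticalPhenomena.RigorousRGSmallParameterWellPosed
import HarnessLib

/-!
# `InfiniteChainDynamics P` is inhabited for every chain `P` (carrier-census witness)

Topic `Literature/MathematicalPhysics/KineticTheory`; companion of `InfiniteChainDynamics.lean`
answering the carrier census (`docs/m5/CARRIER-CENSUS-2026-08-17.md`, unit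
`libB-AtomisticToContinuum-06`): 103 route items of `AtomisticToContinuum/FouriersLaw`
(`BarenblattAnchor.AnchorAbelGreenKubo`, `…AnchorThermodynamicLimit`, `CageBudgetFekete.…`, …)
quantify over `D : InfiniteChainDynamics P`, almost always in the witness form
`∃ ρ D κ, P.IsChainGibbsMeasure T ρ ∧ D.PreservesMeasure ρ ∧ (∀ t, D.HasAbsConvergentCorrelation ρ t) ∧ …`
for the homogeneous quartic ("anchor") chain `P = ⟨μ q⁴/4, r⁴/4, γ⟩`
(`= pureQuarticChain μ γ`, `pureQuarticChain_eq_mk`) or the pinned chain `pinnedChain ω₂ lam β γ`.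

## Answer

1. **Inhabited for every `P`, by junk** (§1). The structure asks for an invariant set `carrier`,
   a flow solving LLL (1a)–(1b) ON the carrier and uniqueness among carrier-valued solutions;
   nothing forces the carrier to be large. The EMPTY dynamics `InfiniteChainDynamics.empty P`
   (carrier `∅`, identity flow) therefore inhabits `InfiniteChainDynamics P` for every
   `P : OscillatorChain` — `InfiniteChainDynamics_nonempty`, registered as an instance — and so does
   the STATIONARY dynamics `InfiniteChainDynamics.stationary P` on the set of equilibria
   `OscillatorChain.equilibria P = {p ≡ 0, F ≡ 0}` (identity flow; the tree's one-point
   `OscillatorChain.restDynamics` is its sub-case `U'(0) = 0`). The type is never a subsingleton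
   (`flow` is unconstrained off the carrier).
2. **No item is made vacuous or trivial by this** (§2). A dynamics preserving a non-zero measure
   has non-empty carrier (`InfiniteChainDynamics.carrier_nonempty_of_preservesMeasure`); the empty
   dynamics preserves exactly the zero measure (`empty_preservesMeasure_iff`), hence never a Gibbs
   state (`not_isChainGibbsMeasure_and_empty_preservesMeasure`): the clause `D.PreservesMeasure ρ`
   with `ρ` a DLR state, carried by every one of the 103 items, excludes the junk inhabitants.
3. **The standard inhabitant at the items' parameters** (§3). For even non-negative polynomial
   `U`, `V` of degrees `≥ 2` the tree PROVES Buttà–Marchioro 2016, Thm 2.1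
   (`OscillatorChain.ButtaMarchioro2016_thm21_chain_holds`) and packages the flow on the
   superstable set `𝒳₀ = bmGood`, measurably extended and preserving every superstable Gibbs state,
   as `OscillatorChain.exists_bmDynamics`. Here this is specialised to the quartic anchor chain
   `⟨μ q⁴/4, r⁴/4, γ⟩`, `μ > 0` (`exists_bmDynamics_pureQuartic`), whose carrier contains the rest
   configuration (`restConfig_mem_bmGood`, any chain), and it is combined with the
   transfer-operator Gibbs state of `exists_isChainGibbsMeasure_hasSuperstabilityEstimate`
   (Georgii 2011, Thm 10.25; the integrability input `e^{-a q⁴} ∈ L¹` is reused from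
   `Literature.Barriers.CriticalPhenomena.LongRangePhi4.integrable_exp_neg_mul_pow_four`, the only
   landed copy of that calculus lemma) into the first two clauses of the items' witness form:
   for every `μ > 0`, `γ`, `T > 0` there are a DLR Gibbs state `ρ` of the anchor chain at `T` and
   an infinite-volume dynamics `D` (carrier `𝒳₀`, measurable flow) with `D.PreservesMeasure ρ`
   (`exists_gibbs_and_bmDynamics_pureQuartic`; the `pinnedChain` analogue is the tree's
   `exists_isChainGibbsMeasure_hasSuperstabilityEstimate_pinnedChain` + `exists_bmDynamics`). The
   remaining clauses of the items (absolutely convergent summed current correlations, a positive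
   Abelian Green–Kubo limit) are their genuine content and are not touched here. For `μ ≤ 0` (no
   confining pinning) Buttà–Marchioro's hypotheses fail and only §1 applies.

Everything below is proved; no definitions of notions beyond the two explicit dynamics and the
equilibrium set, no named facts.

[cite: ButtaMarchioro2016, §2 Thm 2.1 and eq. (2.6)] [cite: LanfordLebowitzLieb1977, §2 eqs. (1a)–(1c)]
[cite: Georgii2011, Thm 10.25 and §11.1]
-/

noncomputable section

open MeasureTheory Filter Set Topology

namespace Literature.MathematicalPhysics.KineticTheory.HeatConduction

/-! ## §1 Unconditional inhabitants -/

namespace OscillatorChain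

/-- The set of **equilibrium configurations** of the chain `P`: all momenta vanish and all forces
balance, `p_i = 0` and `F_i(q) = -U'(q_i) + V'(q_{i+1} - q_i) - V'(q_i - q_{i-1}) = 0` for every
`i ∈ ℤ` (the zeros of the vector field (1a)–(1b)). [cite: LanfordLebowitzLieb1977, §2 eqs. (1a)–(1b)] -/
def equilibria (P : OscillatorChain) : Set ChainConfig :=
  {σ | ∀ i : ℤ, (σ i).2 = 0 ∧ P.force σ i = 0}

/-- Unfolding `equilibria`. [folklore] -/
theorem mem_equilibria_iff (P : OscillatorChain) (σ : ChainConfig) :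
    σ ∈ P.equilibria ↔ ∀ i : ℤ, (σ i).2 = 0 ∧ P.force σ i = 0 :=
  Iff.rfl

/-- The rest configuration is an equilibrium iff `U'(0) = 0` (the interaction forces of a
constant configuration cancel). [folklore] -/
theorem restConfig_mem_equilibria_iff (P : OscillatorChain) :
    restConfig ∈ P.equilibria ↔ deriv P.U 0 = 0 := by
  simp [equilibria, restConfig, OscillatorChain.force, OscillatorChain.interactionForce]

end OscillatorChain

namespace InfiniteChainDynamics

/-- The **empty dynamics**: carrier `∅`, identity flow. Every field of `InfiniteChainDynamics`
quantifies over the carrier, so this inhabits `InfiniteChainDynamics P` for every chain `P`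
(junk: it preserves no non-zero measure, see `empty_preservesMeasure_iff`). [folklore] -/
protected def empty (P : OscillatorChain) : InfiniteChainDynamics P where
  carrier := ∅
  flow := fun _ σ => σ
  mapsTo := fun _ _ h => h
  flow_zero := fun _ _ => rfl
  isSolution := fun σ h => absurd h (Set.notMem_empty σ)
  unique := fun γ h _ _ => absurd (h 0) (Set.notMem_empty (γ 0))

/-- The carrier of the empty dynamics. [folklore] -/
@[simp] theorem empty_carrier (P : OscillatorChain) :
    (InfiniteChainDynamics.empty P).carrier = ∅ :=
  rfl

/-- The flow of the empty dynamics is the identity. [folklore] -/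
@[simp] theorem empty_flow (P : OscillatorChain) (t : ℝ) (σ : ChainConfig) :
    (InfiniteChainDynamics.empty P).flow t σ = σ :=
  rfl

/-- The **stationary dynamics on the equilibrium set**: carrier `P.equilibria`, identity flow.
Constant curves at equilibria solve (1a)–(1b); conversely a solution with values in the
equilibrium set has `dq_i/dt = p_i = 0` and `p_i ≡ 0`, so it is constant (uniqueness). The tree's
`OscillatorChain.restDynamics P hU` (carrier `{restConfig}`) is the one-point sub-case
`U'(0) = 0`. [folklore] -/
protected def stationary (P : OscillatorChain) : InfiniteChainDynamics P where
  carrier := P.equilibria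
  flow := fun _ σ => σ
  mapsTo := fun _ _ h => h
  flow_zero := fun _ _ => rfl
  isSolution := fun σ hσ i t => by
    obtain ⟨hp, hF⟩ := hσ i
    exact ⟨by simpa [hp] using hasDerivAt_const t (σ i).1,
      by simpa [hp, hF] using hasDerivAt_const t (0 : ℝ)⟩
  unique := fun γ hγ hsol t => by
    show γ t = γ 0
    funext i
    have hp : ∀ s : ℝ, (γ s i).2 = 0 := fun s => (hγ s i).1
    have hq : ∀ s : ℝ, HasDerivAt (fun u => (γ u i).1) 0 s := fun s => by
      simpa [hp s] using (hsol i s).1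
    have h1 : (γ t i).1 = (γ 0 i).1 :=
      is_const_of_deriv_eq_zero (fun s => (hq s).differentiableAt) (fun s => (hq s).deriv) t 0
    exact Prod.ext h1 (by rw [hp t, hp 0])

/-- The carrier of the stationary dynamics is the equilibrium set. [folklore] -/
@[simp] theorem stationary_carrier (P : OscillatorChain) :
    (InfiniteChainDynamics.stationary P).carrier = P.equilibria :=
  rfl

/-- The flow of the stationary dynamics is the identity. [folklore] -/
@[simp] theorem stationary_flow (P : OscillatorChain) (t : ℝ) (σ : ChainConfig) :
    (InfiniteChainDynamics.stationary P).flow t σ = σ :=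
  rfl

/-- When `U'(0) = 0` the rest configuration lies in the carrier of the stationary dynamics (which
then extends `OscillatorChain.restDynamics`). [folklore] -/
theorem restConfig_mem_stationary_carrier (P : OscillatorChain) (hU : deriv P.U 0 = 0) :
    restConfig ∈ (InfiniteChainDynamics.stationary P).carrier :=
  (OscillatorChain.restConfig_mem_equilibria_iff P).2 hU

end InfiniteChainDynamics

/-- **Carrier witness.** `InfiniteChainDynamics P` is inhabited for every chain `P` — by the empty
dynamics (carrier `∅`); see §2 for why this does not trivialise any item and §3 for the standard
(Buttà–Marchioro) inhabitant at the items' parameters. [folklore] -/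
theorem InfiniteChainDynamics_nonempty :
    ∀ P : OscillatorChain, Nonempty (InfiniteChainDynamics P) :=
  fun P => ⟨InfiniteChainDynamics.empty P⟩

/-- `InfiniteChainDynamics P` is non-empty for every chain `P` (instance form of
`InfiniteChainDynamics_nonempty`). [folklore] -/
instance (P : OscillatorChain) : Nonempty (InfiniteChainDynamics P) :=
  InfiniteChainDynamics_nonempty P

/-- The empty dynamics as the default inhabitant of `InfiniteChainDynamics P`. [folklore] -/
instance (P : OscillatorChain) : Inhabited (InfiniteChainDynamics P) :=
  ⟨InfiniteChainDynamics.empty P⟩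

/-- `InfiniteChainDynamics P` is never a subsingleton: `flow` is unconstrained off the carrier, so
already over the empty carrier the identity flow and a constant flow give two distinct
inhabitants. [folklore] -/
instance (P : OscillatorChain) : Nontrivial (InfiniteChainDynamics P) := by
  refine ⟨⟨InfiniteChainDynamics.empty P,
    { carrier := ∅
      flow := fun _ _ => restConfig
      mapsTo := fun _ σ h => absurd h (Set.notMem_empty σ)
      flow_zero := fun σ h => absurd h (Set.notMem_empty σ)
      isSolution := fun σ h => absurd h (Set.notMem_empty σ)
      unique := fun γ h _ _ => absurd (h 0) (Set.notMem_empty (γ 0)) }, fun h => ?_⟩⟩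
  have h1 := congrArg
    (fun D : InfiniteChainDynamics P => (D.flow 0 (fun _ => ((1 : ℝ), (0 : ℝ))) 0).1) h
  simp [restConfig] at h1

/-! ## §2 The junk inhabitants serve no item: `PreservesMeasure` forces a non-empty carrier -/

namespace InfiniteChainDynamics

/-- A dynamics preserving a non-zero measure has NON-EMPTY carrier (`PreservesMeasure` asks
`σ ∈ carrier` for `μ`-a.e. `σ`). [folklore] -/
theorem carrier_nonempty_of_preservesMeasure {P : OscillatorChain} (D : InfiniteChainDynamics P)
    {μ : Measure ChainConfig} [NeZero μ] (h : D.PreservesMeasure μ) : D.carrier.Nonempty := by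
  by_contra hne
  exact NeZero.ne μ (D.measure_eq_zero_of_carrier_empty (Set.not_nonempty_iff_eq_empty.1 hne) h)

/-- The empty dynamics preserves exactly the zero measure. [folklore] -/
theorem empty_preservesMeasure_iff (P : OscillatorChain) (μ : Measure ChainConfig) :
    (InfiniteChainDynamics.empty P).PreservesMeasure μ ↔ μ = 0 := by
  refine ⟨fun h => (InfiniteChainDynamics.empty P).measure_eq_zero_of_carrier_empty rfl h, ?_⟩
  rintro rfl
  exact ⟨by simp, fun _ => ⟨measurable_id, by simp⟩⟩

/-- In particular the empty dynamics preserves no non-zero (e.g. probability) measure. [folklore] -/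
theorem empty_not_preservesMeasure (P : OscillatorChain) (μ : Measure ChainConfig) [NeZero μ] :
    ¬ (InfiniteChainDynamics.empty P).PreservesMeasure μ :=
  fun h => NeZero.ne μ ((empty_preservesMeasure_iff P μ).1 h)

/-- The first two clauses of the items' witness form, `P.IsChainGibbsMeasure T ρ ∧ D.PreservesMeasure ρ`,
are never satisfied by the empty dynamics (a Gibbs state is a probability measure). [folklore] -/
theorem not_isChainGibbsMeasure_and_empty_preservesMeasure (P : OscillatorChain) (T : ℝ)
    (μ : Measure ChainConfig) :
    ¬ (P.IsChainGibbsMeasure T μ ∧ (InfiniteChainDynamics.empty P).PreservesMeasure μ) := by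
  rintro ⟨hG, hD⟩
  haveI := hG.isProbabilityMeasure
  exact empty_not_preservesMeasure P μ hD

end InfiniteChainDynamics

/-! ## §3 The standard inhabitant: the Buttà–Marchioro dynamics on the superstable set -/

namespace OscillatorChain

/-- At most two lattice sites are at distance `1` from a given site. [folklore] -/
theorem card_filter_abs_sub_eq_one_le (B : Finset ℤ) (i : ℤ) :
    (B.filter fun j => |j - i| = 1).card ≤ 2 :=
  calc (B.filter fun j => |j - i| = 1).card ≤ ({i - 1, i + 1} : Finset ℤ).card := by
        refine Finset.card_le_card fun j hj => ?_
        rw [Finset.mem_filter] at hj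
        have h := hj.2
        rw [abs_eq (by norm_num : (0 : ℤ) ≤ 1)] at h
        simp only [Finset.mem_insert, Finset.mem_singleton]
        omega
    _ ≤ 2 := Finset.card_le_two

/-- **The rest configuration is a good initial datum**, `restConfig ∈ 𝒳₀`, for every chain:
`W_{μ,k}(0) = (2k+1)(U(0) + 1) + N_{μ,k} V(0)` with `N_{μ,k} ≤ 2(2k+1)` ordered nearest-neighbour
pairs in the box, so `W_{μ,k}(0)/(2k+1) ≤ U(0) + 1 + 2|V(0)|`. [cite: ButtaMarchioro2016, §2 eq. (2.5)] -/
theorem restConfig_mem_bmGood (P : OscillatorChain) : restConfig ∈ P.bmGood := by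
  refine (P.mem_bmGood_of_le (M := P.U 0 + 1 + 2 * |P.V 0|) fun μ k _ => ?_).1
  have hk : (0 : ℝ) < 2 * (k : ℝ) + 1 := by positivity
  rw [div_le_iff₀ hk]
  set B := Finset.Icc (μ - k) (μ + k) with hB
  have hcard : (B.card : ℝ) = 2 * (k : ℝ) + 1 := by
    rw [hB, card_cbox]; push_cast; ring
  have hsite : ∑ i ∈ B, ((restConfig i).2 ^ 2 / 2 + P.U (restConfig i).1 + 1) =
      (2 * (k : ℝ) + 1) * (P.U 0 + 1) := by
    simp only [restConfig]
    rw [Finset.sum_const, nsmul_eq_mul, hcard]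
    ring
  have hpair : ∑ i ∈ B, ∑ j ∈ B,
      (if |j - i| = 1 then P.V ((restConfig i).1 - (restConfig j).1) else 0) ≤
      (2 * (k : ℝ) + 1) * (2 * |P.V 0|) := by
    simp only [restConfig, sub_self]
    calc ∑ i ∈ B, ∑ j ∈ B, (if |j - i| = 1 then P.V 0 else 0)
        ≤ ∑ _i ∈ B, 2 * |P.V 0| := by
          refine Finset.sum_le_sum fun i _ => ?_
          rw [← Finset.sum_filter, Finset.sum_const, nsmul_eq_mul]
          have hc : ((B.filter fun j => |j - i| = 1).card : ℝ) ≤ 2 := by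
            exact_mod_cast card_filter_abs_sub_eq_one_le B i
          calc ((B.filter fun j => |j - i| = 1).card : ℝ) * P.V 0
              ≤ ((B.filter fun j => |j - i| = 1).card : ℝ) * |P.V 0| :=
                mul_le_mul_of_nonneg_left (le_abs_self _) (Nat.cast_nonneg _)
            _ ≤ 2 * |P.V 0| := mul_le_mul_of_nonneg_right hc (abs_nonneg _)
      _ = (2 * (k : ℝ) + 1) * (2 * |P.V 0|) := by
          rw [Finset.sum_const, nsmul_eq_mul, hcard]
  unfold bmLocalEnergy
  rw [← hB, hsite]
  nlinarith [hpair]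

/-- The pinning `U(q) = μ q⁴/4` of the quartic anchor chain is an even non-negative polynomial of
degree `4 = 2·2` when `μ > 0` (`σ₁ = 2`). [folklore] -/
theorem pureQuartic_isEvenPolyOfDegree_U {μ : ℝ} (γ : ℝ) (hμ : 0 < μ) :
    IsEvenPolyOfDegree (OscillatorChain.mk (fun q => μ * q ^ 4 / 4) (fun r => r ^ 4 / 4) γ).U 2 := by
  refine ⟨fun m => if m = 2 then μ / 4 else 0, ?_, ?_, ?_⟩
  · simp [hμ]
  · intro x
    show μ * x ^ 4 / 4 = _
    simp
    ring
  · intro x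
    show 0 ≤ μ * x ^ 4 / 4
    positivity

/-- The coupling `V(r) = r⁴/4` of the quartic anchor chain is an even non-negative polynomial of
degree `4 = 2·2` (`σ₂ = 2`). [folklore] -/
theorem pureQuartic_isEvenPolyOfDegree_V (μ γ : ℝ) :
    IsEvenPolyOfDegree (OscillatorChain.mk (fun q => μ * q ^ 4 / 4) (fun r => r ^ 4 / 4) γ).V 2 := by
  refine ⟨fun m => if m = 2 then 1 / 4 else 0, ?_, ?_, ?_⟩
  · simp
  · intro x
    show x ^ 4 / 4 = _
    simp
    ring
  · intro x
    show 0 ≤ x ^ 4 / 4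
    positivity

/-- **The Buttà–Marchioro dynamics of the quartic anchor chain** `⟨μ q⁴/4, r⁴/4, γ⟩`, `μ > 0`
(the tree's `exists_bmDynamics` at `σ₁ = σ₂ = 2`): an infinite-volume dynamics with carrier the
superstable set `𝒳₀ = bmGood`, measurable flow maps, the group law on `𝒳₀`, preserving every DLR
Gibbs state that obeys the superstability estimate (2.3), at every temperature.
[cite: ButtaMarchioro2016, §2 Thm 2.1 and eq. (2.6)] -/
theorem exists_bmDynamics_pureQuartic {μ : ℝ} (γ : ℝ) (hμ : 0 < μ) :
    ∃ D : InfiniteChainDynamics (OscillatorChain.mk (fun q => μ * q ^ 4 / 4) (fun r => r ^ 4 / 4) γ),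
      D.carrier = (OscillatorChain.mk (fun q => μ * q ^ 4 / 4) (fun r => r ^ 4 / 4) γ).bmGood ∧
      (∀ t : ℝ, Measurable (D.flow t)) ∧
      (∀ t s : ℝ, ∀ σ ∈ (OscillatorChain.mk (fun q => μ * q ^ 4 / 4) (fun r => r ^ 4 / 4) γ).bmGood,
        D.flow (t + s) σ = D.flow t (D.flow s σ)) ∧
      ∀ (T : ℝ) (ρ : Measure ChainConfig),
        (OscillatorChain.mk (fun q => μ * q ^ 4 / 4) (fun r => r ^ 4 / 4) γ).IsChainGibbsMeasure T ρ →
        (OscillatorChain.mk (fun q => μ * q ^ 4 / 4) (fun r => r ^ 4 / 4) γ).HasSuperstabilityEstimate ρ →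
        D.PreservesMeasure ρ := by
  obtain ⟨D, hcar, hmeas, -, hgrp, -, -, hpres⟩ :=
    exists_bmDynamics (P := OscillatorChain.mk (fun q => μ * q ^ 4 / 4) (fun r => r ^ 4 / 4) γ)
      (s₁ := 2) (s₂ := 2) (by norm_num) (by norm_num)
      (pureQuartic_isEvenPolyOfDegree_U γ hμ) (pureQuartic_isEvenPolyOfDegree_V μ γ)
  exact ⟨D, hcar, hmeas, hgrp, hpres⟩

/-- The carrier of any such dynamics is non-empty: it contains the rest configuration. [folklore] -/
theorem exists_infiniteChainDynamics_carrier_nonempty_pureQuartic {μ : ℝ} (γ : ℝ) (hμ : 0 < μ) :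
    ∃ D : InfiniteChainDynamics (OscillatorChain.mk (fun q => μ * q ^ 4 / 4) (fun r => r ^ 4 / 4) γ),
      restConfig ∈ D.carrier := by
  obtain ⟨D, hcar, -⟩ := exists_bmDynamics_pureQuartic γ hμ
  exact ⟨D, hcar ▸ restConfig_mem_bmGood _⟩

/-- **A superstable DLR Gibbs state of the quartic anchor chain** `⟨μ q⁴/4, r⁴/4, γ⟩`, `μ > 0`, at
every `T > 0`: the transfer-operator (two-sided stationary Markov chain) state of
`exists_isChainGibbsMeasure_hasSuperstabilityEstimate` (`U, V ≥ 0` continuous, `V` even,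
`e^{-U/T}, e^{-U/(2T)} ∈ L¹`; the integrability of `q ↦ e^{-a q⁴}`, `a > 0`, is the tree's
`Literature.Barriers.CriticalPhenomena.LongRangePhi4.integrable_exp_neg_mul_pow_four`).
[cite: Georgii2011, Thm 10.25 and §11.1] -/
theorem exists_isChainGibbsMeasure_hasSuperstabilityEstimate_pureQuartic {μ : ℝ} (γ : ℝ)
    (hμ : 0 < μ) {T : ℝ} (hT : 0 < T) :
    ∃ ρ : Measure ChainConfig,
      (OscillatorChain.mk (fun q => μ * q ^ 4 / 4) (fun r => r ^ 4 / 4) γ).IsChainGibbsMeasure T ρ ∧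
      (OscillatorChain.mk (fun q => μ * q ^ 4 / 4) (fun r => r ^ 4 / 4) γ).HasSuperstabilityEstimate ρ := by
  have hint : ∀ S : ℝ, 0 < S →
      Integrable (fun q : ℝ => Real.exp (-S⁻¹ * (μ * q ^ 4 / 4))) := by
    intro S hS
    have h := Literature.Barriers.CriticalPhenomena.LongRangePhi4.integrable_exp_neg_mul_pow_four
      (a := S⁻¹ * μ / 4) (by positivity)
    refine h.congr (Eventually.of_forall fun q => ?_)
    show Real.exp (-(S⁻¹ * μ / 4 * q ^ 4)) = Real.exp (-S⁻¹ * (μ * q ^ 4 / 4))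
    congr 1
    ring
  refine (OscillatorChain.mk (fun q => μ * q ^ 4 / 4) (fun r => r ^ 4 / 4) γ)
    |>.exists_isChainGibbsMeasure_hasSuperstabilityEstimate hT ?_ ?_ ?_ ?_ ?_ (hint T hT)
      (hint (2 * T) (by positivity))
  · show Continuous fun q : ℝ => μ * q ^ 4 / 4
    fun_prop
  · show Continuous fun r : ℝ => r ^ 4 / 4
    fun_prop
  · intro q
    show 0 ≤ μ * q ^ 4 / 4
    positivity
  · intro r
    show 0 ≤ r ^ 4 / 4
    positivity
  · intro r
    show (-r) ^ 4 / 4 = r ^ 4 / 4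
    ring

/-- **The items' witness form, first two clauses, at the anchor.** For every `μ > 0`, `γ` and
`T > 0` the quartic anchor chain `⟨μ q⁴/4, r⁴/4, γ⟩` carries a DLR Gibbs state `ρ` (obeying the
superstability estimate (2.3)) and an infinite-volume dynamics `D` with carrier `𝒳₀`, measurable
flow maps and `D.PreservesMeasure ρ` — the non-degenerate inhabitant of `InfiniteChainDynamics`
relevant to the `BarenblattAnchor` / `CageBudgetFekete` items (whose remaining clauses — summable
current correlations, a positive Abelian Green–Kubo limit — are not asserted here).
[cite: ButtaMarchioro2016, §2 Thm 2.1 and eq. (2.6)] -/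
theorem exists_gibbs_and_bmDynamics_pureQuartic {μ : ℝ} (γ : ℝ) (hμ : 0 < μ) {T : ℝ} (hT : 0 < T) :
    ∃ (ρ : Measure ChainConfig)
      (D : InfiniteChainDynamics (OscillatorChain.mk (fun q => μ * q ^ 4 / 4) (fun r => r ^ 4 / 4) γ)),
      (OscillatorChain.mk (fun q => μ * q ^ 4 / 4) (fun r => r ^ 4 / 4) γ).IsChainGibbsMeasure T ρ ∧
      (OscillatorChain.mk (fun q => μ * q ^ 4 / 4) (fun r => r ^ 4 / 4) γ).HasSuperstabilityEstimate ρ ∧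
      D.carrier = (OscillatorChain.mk (fun q => μ * q ^ 4 / 4) (fun r => r ^ 4 / 4) γ).bmGood ∧
      (∀ t : ℝ, Measurable (D.flow t)) ∧
      D.PreservesMeasure ρ := by
  obtain ⟨ρ, hG, hSS⟩ := exists_isChainGibbsMeasure_hasSuperstabilityEstimate_pureQuartic γ hμ hT
  obtain ⟨D, hcar, hmeas, -, hpres⟩ := exists_bmDynamics_pureQuartic γ hμ
  exact ⟨ρ, D, hG, hSS, hcar, hmeas, hpres T ρ hG hSS⟩

end OscillatorChain

end Literature.MathematicalPhysics.KineticTheory.HeatConduction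

end
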